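import Summits.NavierStokesRegularity.NavierStokesRegularity.Theorems.ApexLocalisation.Negative.LinesVacuity

/-!
# `ApexLocalisation` (crux stmt-NavierStokesRegularity-11719): the lines' first lemmas, II —
# the load-bearing hypotheses of the dissipation quantum, the confinement criterion and
# final-slice sparsity — negative-side support (cdisprove seat, gen 3)

Sixth file of importable lemmas of the standing disprover of `RellichScar.ApexLocalisation`
(companions: `Negative/LogicAndLoadBearing.lean`, `Negative/FinalSlice.lean`, `Negative/AEForm.lean`,
`Negative/KinematicLoadBearing.lean`, `Negative/LinesVacuity.lean` — imported, §0–§A —). It concerns the typed first lemmas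
of the crux lines published in `Cruxes/ApexLocalisation/SketchIdeator1.lean`
(`RateClassSingular`, `AnnularDissipationQuantum(Exists)`, `LowDissipationIsolation` — line
`dissipation-quantum-tolerance`) and `Cruxes/ApexLocalisation/Ideator3Sketch.lean`
(`Sketch.InRateClass`, `Sketch.ConfinementImpliesApex`, `Sketch.FinalSliceRadialNull` — lines
`activity-genealogy-fission` / `baire-onion-normal-form`). `Theorems/` files may not import crux
workfiles, so §0 re-declares those statements VERBATIM in the sub-namespace `Lines` (the
disprover's work file `Cruxes/ApexLocalisation/Disproof.lean` imports both and certifies the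
copies are definitionally the originals, by `Iff.rfl`). All sorry-free. This file holds §B–§D.

* §A DICTIONARY AND (L)-VACUITY. `RateClassSingular C M` (the ideators' hypothesis class with the
  constants exposed) is exactly the disprover's `IsRateProfile C` with `𝐈 ≤ M`
  (`rateProfileExists_iff_exists_rateClassSingular`). Consequently EVERY stub of the shape
  `∀ (u,p,G) ∈ RateClassSingular C M, …` follows from `¬ RateProfileExists` (= stmt-1588, the
  situation under the KNSS Liouville conjecture) — `forall_rateClassSingular_of_not_rateProfileExists` —
  and every stub of the shape `∃ (u,p,G) ∈ RateClassSingular C M, …` EXHIBITS a Type-I singularity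
  (`localTypeISingularityExists_of_exists_rateClassSingular`, Albritton–Barker's open first
  bullet). In particular `AnnularDissipationQuantum(Exists)` and `LowDissipationIsolation` are
  (L)-theorems for free (`…_of_not_rateProfileExists`): like the crux itself
  (`Negative/LogicAndLoadBearing`), no universal stub of these lines is refutable short of a
  Type-I blow-up, and an unguarded existential stub ("the band infimum is ATTAINED by a profile")
  is at least as hard as constructing one. The disprover can therefore only kill MIS-STATEMENTS;
  §B–§D record which omissions are fatal.
* §B THE DISSIPATION QUANTUM NEEDS `𝐈 ≤ M` AND THE SINGULAR POINT. With `𝐈 ≤ M` dropped the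
  quantum fails for every `C > 0`, `e > 0` (`annularDissipationQuantum_false_without_I`): the
  parasitic flow `u = C e₀/√(−t)` (KNSS 2009 §1; library `ParasiticSlabFlow`) is a suitable weak
  solution with the rate, singular at the origin, and has ZERO dissipation (`∇u = 0`). With the
  singular origin dropped it fails by the zero flow (`annularDissipationQuantum_false_without_Sing`).
  For `e ≤ 0` the quantum is trivially true (`annularDissipationQuantum_of_nonpos`); it is antitone
  in `e`, `M` and monotone in `C` (bookkeeping for the prover).
* §C THE CONFINEMENT CRITERION NEEDS `𝐈 ≤ M`. `Sketch.ConfinementImpliesApex` with the Morrey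
  bound dropped is false (`confinementImpliesApex_false_without_I`): the SMALL parasitic flow
  `u = a e₀/√(−t)`, `a = min η 1`, is `η`-confined (indeed `√(−t)‖u‖ = a` everywhere), has the
  rate with constant `1`, and violates every a.e. apex bound on the positive-measure set
  `(−1,−¼) × B₁(x₀)`, `‖x₀‖ = |C'|/a + 3`. So the threshold `η` cannot absorb the Morrey input:
  localized smoothing genuinely needs `A ≤ 𝐈 ≤ M`, as the card says.
* §D FINAL-SLICE SPARSITY NEEDS `𝐈 ≤ M`. `Sketch.FinalSliceRadialNull` with the Morrey bound
  dropped is false (`finalSliceRadialNull_false_without_I`): the parasitic flow is singular at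
  every final-slice point (`Negative/FinalSlice`: `Σ = ℝ³`), so the radial image of `Σ` is
  `[0, ∞)`, of infinite length.
* §E ACTIVITY MUST BE ASSUMED. The zero flow is in every `InRateClass M C` (`C ≥ 0`) and has empty
  `η`-active set, so every stub "∀ flows of `InRateClass`, ∃ an active point with …" is false
  (`not_forall_inRateClass_exists_active`) — the degenerate case flagged by triage r1-3 for the
  card's `NoPerpetualFission`; over `RateClassSingular` the same shape is (L)-vacuous instead.

## References

* G. Koch, N. Nadirashvili, G. Seregin, V. Šverák, Acta Math. 203 (2009), §1 (parasitic solutions; (1.4), (1.6)). [KNSS2009]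
* D. Albritton, T. Barker, J. Math. Fluid Mech. 21 (2019) = arXiv:1811.00502, §1, Thm 1.1. [AlbrittonBarker2019]
* L. Caffarelli, R. Kohn, L. Nirenberg, CPAM 35 (1982), §2, §6. [CaffarelliKohnNirenberg1982]
-/

noncomputable section

open MeasureTheory TopologicalSpace Set Function Filter Topology Metric
open scoped InnerProductSpace RealInnerProductSpace ENNReal NNReal
open Literature.Analysis.FluidPDE
open Summit.NavierStokesRegularity.NavierStokesRegularity.Theses

set_option linter.dupNamespace false

namespace Summit.NavierStokesRegularity.NavierStokesRegularity.Theorems.ApexLocalisation.Negative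

/-- Physical space. -/
local notation "ℝ³" => EuclideanSpace ℝ (Fin 3)

/-- The open backward slab `(-∞,0) × ℝ³` (time first), as in the route file. -/
local notation "𝕊" => Literature.Analysis.FluidPDE.slab (EuclideanSpace ℝ (Fin 3)) (Set.Iio (0 : ℝ)) isOpen_Iio

open Lines

variable {C M e : ℝ} {u : ℝ → ℝ³ → ℝ³} {p : ℝ → ℝ³ → ℝ} {G : ℝ → ℝ³ → ℝ³ →L[ℝ] ℝ³}

/-! ## §B The dissipation quantum: trivial range, monotonicity, load-bearing hypotheses -/

/-- For `e ≤ 0` the quantum is trivially true (`ofReal e = 0`). -/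
theorem annularDissipationQuantum_of_nonpos (he : e ≤ 0) (C M : ℝ) :
    AnnularDissipationQuantum C M e := by
  intro u p G _
  rw [ENNReal.ofReal_of_nonpos he]
  exact zero_le

/-- The quantum is antitone in `e`. -/
theorem AnnularDissipationQuantum.anti {e' : ℝ} (h : AnnularDissipationQuantum C M e) (he : e' ≤ e) :
    AnnularDissipationQuantum C M e' :=
  fun u p G hu => (ENNReal.ofReal_le_ofReal he).trans (h u p G hu)

/-- The quantum is antitone in `M` (a smaller `𝐈`-bound is a smaller class). -/
theorem AnnularDissipationQuantum.anti_M {M' : ℝ} (h : AnnularDissipationQuantum C M e)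
    (hM : M' ≤ M) : AnnularDissipationQuantum C M' e :=
  fun u p G hu => h u p G ⟨hu.1, hu.2.1, hu.2.2.1.trans (ENNReal.ofReal_le_ofReal hM), hu.2.2.2⟩

/-- The rate class grows with `C`. -/
theorem hasTypeITimeDecay_mono_const {C C' : ℝ} {u : ℝ → ℝ³ → ℝ³} (h : HasTypeITimeDecay C' u)
    (hC : C' ≤ C) : HasTypeITimeDecay C u :=
  fun t ht x => (h t ht x).trans (div_le_div_of_nonneg_right hC (Real.sqrt_nonneg _))

/-- The quantum is antitone in `C` as a hypothesis, i.e. it transfers to smaller rate constants. -/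
theorem AnnularDissipationQuantum.anti_C {C' : ℝ} (h : AnnularDissipationQuantum C M e)
    (hC : C' ≤ C) : AnnularDissipationQuantum C' M e :=
  fun u p G hu => h u p G ⟨hu.1, hu.2.1, hu.2.2.1, hasTypeITimeDecay_mono_const hu.2.2.2.1 hC, hu.2.2.2.2⟩

/-- The quantum with `𝐈 ≤ M` DROPPED from the class (everything else verbatim). -/
def AnnularDissipationQuantumWithoutI (C e : ℝ) : Prop :=
  ∀ (u : ℝ → ℝ³ → ℝ³) (p : ℝ → ℝ³ → ℝ) (G : ℝ → ℝ³ → ℝ³ →L[ℝ] ℝ³),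
    IsSuitableWeakSolutionOn 𝕊 1 0 u p → HasWeakSpatialGradientOn 𝕊 u G →
      HasTypeITimeDecay C u → IsBackwardSingularPoint u 0 →
        ENNReal.ofReal e ≤
          ∫⁻ q in (Ioo (-1 : ℝ) (-1 / 4)) ×ˢ ball (0 : ℝ³) 1, ENNReal.ofReal (frobeniusNormSq (G q.1 q.2))

/-- The parasitic velocity is spatially constant: its spatial derivative vanishes. -/
theorem fderiv_parasiticVelocity (C t : ℝ) (x : ℝ³) : fderiv ℝ (parasiticVelocity C t) x = 0 := by
  show fderiv ℝ (fun _ : ℝ³ => parasiticAmp C t • parasiticDir) x = 0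
  exact fderiv_const_apply _

/-- **The parasitic flow dissipates NOTHING**: `∫∫_s |∇u|² = 0` on every space–time set. -/
theorem parasitic_dissipation_zero (C : ℝ) (s : Set (ℝ × ℝ³)) :
    ∫⁻ q in s, ENNReal.ofReal
        (frobeniusNormSq ((fun (t : ℝ) (x : ℝ³) => fderiv ℝ (parasiticVelocity C t) x) q.1 q.2)) = 0 := by
  simp [fderiv_parasiticVelocity, frobeniusNormSq_zero]

/-- **`𝐈 ≤ M` is load-bearing in the quantum**: without it the quantum fails for every `C > 0`
and every `e > 0` — the parasitic flow `u = C e₀/√(−t)` is a suitable weak solution on the slab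
with the (saturated) rate, singular at the origin, with zero dissipation. (It has `𝐈 = ⊤`,
`parasitic_typeIBound_eq_top`.) Any proof of the quantum must use the Morrey bound, e.g. through
`A(Q(z,r)) ~ r²|b(t)|² ≤ M` to kill the spatially constant limits `u = b(t)` of the card's
unique-continuation step. -/
theorem annularDissipationQuantum_false_without_I (hC : 0 < C) (he : 0 < e) :
    ¬ AnnularDissipationQuantumWithoutI C e := by
  intro h
  have key := h _ _ _ (parasitic_isSuitableWeakSolutionOn C) (parasitic_hasWeakSpatialGradientOn C)
    (parasitic_hasTypeITimeDecay hC.le) (parasitic_isBackwardSingularPoint_zero hC)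
  rw [parasitic_dissipation_zero] at key
  exact (ENNReal.ofReal_pos.2 he).ne' (le_zero_iff.1 key)

/-- Existential form: without `𝐈 ≤ M` there is no positive quantum at all. -/
theorem not_exists_quantum_without_I (hC : 0 < C) :
    ¬ ∃ e : ℝ, 0 < e ∧ AnnularDissipationQuantumWithoutI C e :=
  fun ⟨_, he, h⟩ => annularDissipationQuantum_false_without_I hC he h

/-- The quantum with the SINGULAR ORIGIN dropped from the class. -/
def AnnularDissipationQuantumWithoutSing (C M e : ℝ) : Prop :=
  ∀ (u : ℝ → ℝ³ → ℝ³) (p : ℝ → ℝ³ → ℝ) (G : ℝ → ℝ³ → ℝ³ →L[ℝ] ℝ³),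
    IsSuitableWeakSolutionOn 𝕊 1 0 u p → HasWeakSpatialGradientOn 𝕊 u G →
      typeIBound (Set.Iio (0 : ℝ) ×ˢ Set.univ) u p G ≤ ENNReal.ofReal M → HasTypeITimeDecay C u →
        ENNReal.ofReal e ≤
          ∫⁻ q in (Ioo (-1 : ℝ) (-1 / 4)) ×ˢ ball (0 : ℝ³) 1, ENNReal.ofReal (frobeniusNormSq (G q.1 q.2))

/-- **The singular origin is load-bearing in the quantum**: the zero flow (`𝐈 = 0 ≤ ofReal M`
for every `M`) is in the class without it and dissipates nothing. -/
theorem annularDissipationQuantum_false_without_Sing (hC : 0 ≤ C) (M : ℝ) (he : 0 < e) :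
    ¬ AnnularDissipationQuantumWithoutSing C M e := by
  intro h
  have hs := parasitic_isSuitableWeakSolutionOn 0
  have hg := parasitic_hasWeakSpatialGradientOn 0
  rw [parasiticVelocity_zero] at hs hg
  rw [parasiticPressure_zero] at hs
  have hG : (fun (t : ℝ) (x : ℝ³) => fderiv ℝ ((0 : ℝ → ℝ³ → ℝ³) t) x) = 0 := by
    funext t x
    simp
  rw [hG] at hg
  have hI : typeIBound (Set.Iio (0 : ℝ) ×ˢ Set.univ) (0 : ℝ → ℝ³ → ℝ³) 0 0 ≤ ENNReal.ofReal M := by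
    rw [typeIBound_zero]
    exact zero_le
  have hrate : HasTypeITimeDecay C (0 : ℝ → ℝ³ → ℝ³) := fun t _ x => by
    simp only [Pi.zero_apply, norm_zero]
    positivity
  have key := h 0 0 0 hs hg hI hrate
  simp only [Pi.zero_apply, frobeniusNormSq_zero, ENNReal.ofReal_zero, lintegral_const, zero_mul,
    nonpos_iff_eq_zero, ENNReal.ofReal_eq_zero] at key
  linarith

/-! ## §C The confinement criterion (`activity-genealogy-fission`): `𝐈 ≤ M` is load-bearing -/

/-- If a property fails everywhere on a subset `V ⊆ Ω` of positive measure, it does not hold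
almost everywhere on `Ω`. -/
theorem not_ae_restrict_of_forall_not {α : Type*} [MeasurableSpace α] {μ : Measure α} {Ω V : Set α}
    {P : α → Prop} (hΩ : MeasurableSet Ω) (hVΩ : V ⊆ Ω) (hV : μ V ≠ 0) (hfail : ∀ z ∈ V, ¬ P z) :
    ¬ ∀ᵐ z ∂(μ.restrict Ω), P z := by
  intro hae
  have h0 : (μ.restrict Ω) {z | ¬ P z} = 0 := ae_iff.1 hae
  have h1 : (μ.restrict Ω) V = 0 := measure_mono_null (fun z hz => hfail z hz) h0
  rw [Measure.restrict_apply' hΩ, inter_eq_left.2 hVΩ] at h1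
  exact hV h1

/-- The slab box `(−1,−¼) × B₁(x₀)` has positive space–time measure. -/
theorem volume_box_ne_zero (x₀ : ℝ³) :
    volume (Ioo (-1 : ℝ) (-1 / 4) ×ˢ ball x₀ 1) ≠ 0 := by
  rw [Measure.volume_eq_prod, Measure.prod_prod]
  refine mul_ne_zero ?_ (measure_ball_pos volume x₀ one_pos).ne'
  rw [Real.volume_Ioo, Ne, ENNReal.ofReal_eq_zero, not_le]
  norm_num

/-- `ConfinementImpliesApex` with the Morrey bound `𝐈 ≤ M` DROPPED from `InRateClass`
(so the bound `M` disappears; everything else verbatim, including the quantifier pattern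
`∀ C, ∃ η > 0, ∀ R > 0, ∃ C', ∀ (u,p,G), …`). -/
def ConfinementImpliesApexWithoutI : Prop :=
  ∀ C : ℝ, ∃ η : ℝ, 0 < η ∧ ∀ R : ℝ, 0 < R → ∃ C' : ℝ,
    ∀ (u : ℝ → ℝ³ → ℝ³) (p : ℝ → ℝ³ → ℝ) (G : ℝ → ℝ³ → ℝ³ →L[ℝ] ℝ³),
      IsSuitableWeakSolutionOn 𝕊 1 0 u p → HasWeakSpatialGradientOn 𝕊 u G → HasTypeITimeDecay C u →
      (∀ t : ℝ, t < 0 → ∀ x : ℝ³, R * Real.sqrt (-t) ≤ ‖x‖ → Real.sqrt (-t) * ‖u t x‖ ≤ η) →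
      ∀ᵐ z : ℝ × ℝ³ ∂(volume.restrict (Iio (0 : ℝ) ×ˢ univ)),
        ‖u z.1 z.2‖ ≤ C' / (‖z.2‖ + Real.sqrt (-z.1))

/-- **`𝐈 ≤ M` is load-bearing in the confinement criterion.** For `C = 1` and any threshold
`η > 0`, the small parasitic flow `u = a e₀/√(−t)`, `a = min η 1`, is an honest suitable weak
solution with the rate (constant `1`), is `η`-confined for EVERY aperture `R` (indeed
`√(−t)‖u‖ = a ≤ η` everywhere), yet violates the a.e. apex bound with any constant `C'` on the
box `(−1,−¼) × B₁(x₀)`, `x₀ = (|C'|/a + 3) e₀`. So smallness outside a paraboloid does not by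
itself give the `C'/‖x‖` law: the localized-smoothing engine needs the Morrey input `A ≤ 𝐈 ≤ M`
(and it is `𝐈 < ⊤`, not the rate, that kills the parasitic directions, `parasitic_typeIBound_eq_top`). -/
theorem confinementImpliesApex_false_without_I : ¬ ConfinementImpliesApexWithoutI := by
  intro h
  obtain ⟨η, hη, hR⟩ := h 1
  obtain ⟨C', hC'⟩ := hR 1 one_pos
  set a : ℝ := min η 1 with ha
  have ha0 : 0 < a := lt_min hη one_pos
  have ha1 : a ≤ 1 := min_le_right _ _
  have haη : a ≤ η := min_le_left _ _
  have hrate : HasTypeITimeDecay 1 (parasiticVelocity a) :=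
    hasTypeITimeDecay_mono_const (parasitic_hasTypeITimeDecay ha0.le) ha1
  have hconf : ∀ t : ℝ, t < 0 → ∀ x : ℝ³, 1 * Real.sqrt (-t) ≤ ‖x‖ →
      Real.sqrt (-t) * ‖parasiticVelocity a t x‖ ≤ η := by
    intro t ht x _
    have hs : 0 < Real.sqrt (-t) := Real.sqrt_pos.2 (by linarith)
    rw [norm_parasiticVelocity ha0.le, mul_div_cancel₀ _ hs.ne']
    exact haη
  have hae := hC' _ _ _ (parasitic_isSuitableWeakSolutionOn a) (parasitic_hasWeakSpatialGradientOn a)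
    hrate hconf
  -- the a.e. apex bound fails on the box `(−1,−¼) × B₁(x₀)`, `x₀ = (|C'|/a + 3) e₀`
  set L : ℝ := |C'| / a + 3 with hL
  have hL3 : 3 ≤ L := by
    have : 0 ≤ |C'| / a := by positivity
    linarith
  set x₀ : ℝ³ := L • parasiticDir with hx₀
  have hnx₀ : ‖x₀‖ = L := by
    rw [hx₀, norm_smul, norm_parasiticDir, mul_one, Real.norm_of_nonneg (by linarith)]
  refine not_ae_restrict_of_forall_not (μ := volume) (measurableSet_Iio.prod MeasurableSet.univ)
    ?_ (volume_box_ne_zero x₀) ?_ hae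
  · rintro ⟨t, x⟩ ⟨⟨-, ht⟩, -⟩
    exact ⟨show t < 0 by linarith [ht], mem_univ _⟩
  · rintro ⟨t, x⟩ ⟨⟨ht1, ht2⟩, hx⟩ hle
    simp only at hle ht1 ht2 hx
    have hs0 : 0 < Real.sqrt (-t) := Real.sqrt_pos.2 (by linarith)
    have hs1 : Real.sqrt (-t) ≤ 1 := by
      rw [show (1 : ℝ) = Real.sqrt 1 by simp]
      exact Real.sqrt_le_sqrt (by linarith)
    -- ‖x‖ ≥ L - 1
    have hxL : L - 1 ≤ ‖x‖ := by
      have h1 : dist x x₀ < 1 := mem_ball.1 hx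
      rw [dist_eq_norm] at h1
      have h2 : ‖x₀‖ ≤ ‖x‖ + ‖x - x₀‖ := by
        calc ‖x₀‖ = ‖x - (x - x₀)‖ := by rw [sub_sub_cancel]
          _ ≤ ‖x‖ + ‖x - x₀‖ := norm_sub_le _ _
      linarith
    rw [norm_parasiticVelocity ha0.le] at hle
    -- `a/√(−t) ≤ C'/(‖x‖ + √(−t))` with `√(−t) ≤ 1`, `‖x‖ ≥ |C'|/a + 2` is absurd
    have hden : 0 < ‖x‖ + Real.sqrt (-t) := by positivity
    rw [div_le_div_iff₀ hs0 hden] at hle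
    -- hle : a * (‖x‖ + √(-t)) ≤ C' * √(-t)
    have h3 : C' * Real.sqrt (-t) ≤ |C'| := by
      calc C' * Real.sqrt (-t) ≤ |C'| * Real.sqrt (-t) :=
            mul_le_mul_of_nonneg_right (le_abs_self _) hs0.le
        _ ≤ |C'| * 1 := mul_le_mul_of_nonneg_left hs1 (abs_nonneg _)
        _ = |C'| := mul_one _
    have h4 : a * (L - 1) ≤ a * (‖x‖ + Real.sqrt (-t)) :=
      mul_le_mul_of_nonneg_left (by linarith [hs0.le]) ha0.le
    have h5 : a * (L - 1) = |C'| + 2 * a := by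
      rw [hL]
      field_simp
      ring
    linarith

/-! ## §D Final-slice sparsity (`baire-onion-normal-form`, shared support): `𝐈 ≤ M` is load-bearing -/

/-- `FinalSliceRadialNull` with the Morrey bound `𝐈 ≤ M` DROPPED from `InRateClass`
(keeping only its radial-image conclusion, the weakest conjunct). -/
def FinalSliceRadialNullWithoutI : Prop :=
  ∀ (C : ℝ) (u : ℝ → ℝ³ → ℝ³) (p : ℝ → ℝ³ → ℝ) (G : ℝ → ℝ³ → ℝ³ →L[ℝ] ℝ³),
    IsSuitableWeakSolutionOn 𝕊 1 0 u p → HasWeakSpatialGradientOn 𝕊 u G → HasTypeITimeDecay C u →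
      ∀ x₀ : ℝ³, volume ((fun x : ℝ³ => ‖x - x₀‖) '' finalSingularSet u) = 0

/-- The parasitic flow's final-time singular set, in the ideators' notation, is all of `ℝ³`. -/
theorem lines_finalSingularSet_parasitic (hC : 0 < C) :
    finalSingularSet (parasiticVelocity C) = univ :=
  eq_univ_of_forall fun x => parasitic_isBackwardSingularPoint hC x

/-- The radial image of `ℝ³` about any centre is `[0, ∞)`. -/
theorem radial_image_univ (x₀ : ℝ³) : (fun x : ℝ³ => ‖x - x₀‖) '' (univ : Set ℝ³) = Ici 0 := by
  ext r
  simp only [mem_image, mem_univ, true_and, mem_Ici]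
  constructor
  · rintro ⟨x, rfl⟩
    exact norm_nonneg _
  · intro hr
    refine ⟨x₀ + r • parasiticDir, ?_⟩
    rw [add_sub_cancel_left, norm_smul, norm_parasiticDir, mul_one, Real.norm_of_nonneg hr]

/-- **`𝐈 ≤ M` is load-bearing in final-slice sparsity**: without it the parasitic flow (suitable,
rate, `Σ = ℝ³`) has radial singular image `[0, ∞)` of infinite length. (CKN's `𝓟¹(Σ) = 0` enters
only through the scaled quantities `A, C, D, E ≤ 𝐈` on cylinders touching the final slice.) -/
theorem finalSliceRadialNull_false_without_I : ¬ FinalSliceRadialNullWithoutI := by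
  intro h
  have key := h 1 _ _ _ (parasitic_isSuitableWeakSolutionOn 1) (parasitic_hasWeakSpatialGradientOn 1)
    (parasitic_hasTypeITimeDecay zero_le_one) 0
  rw [lines_finalSingularSet_parasitic one_pos, radial_image_univ, Real.volume_Ici] at key
  exact ENNReal.top_ne_zero key


/-! ## §E Activity (`activity-genealogy-fission`): the zero flow is in `InRateClass` and has NO
active point — a stub "∀ flows of the rate class, ∃ an `η`-active point `z₀` with …" (the shape of
the card's Transfer `NoPerpetualFission` / clean-trunk statements when written over `InRateClass`)
is FALSE unless it assumes a singular, or at least an active, point (triage r1-3 (a)) -/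

/-- The card's `η`-active set `A_η(u) = {(t,x) : t < 0, √(−t)‖u(t,x)‖ ≥ η}` (rate usage ≥ η). -/
def activeSet (η : ℝ) (u : ℝ → ℝ³ → ℝ³) : Set (ℝ × ℝ³) :=
  {z | z.1 < 0 ∧ η ≤ Real.sqrt (-z.1) * ‖u z.1 z.2‖}

/-- The zero flow has no `η`-active point for `η > 0`. -/
theorem activeSet_zero {η : ℝ} (hη : 0 < η) : activeSet η (0 : ℝ → ℝ³ → ℝ³) = ∅ := by
  ext z
  simp only [activeSet, Pi.zero_apply, norm_zero, mul_zero, mem_setOf_eq, mem_empty_iff_false,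
    iff_false, not_and, not_le]
  exact fun _ => hη

/-- The zero pair is a suitable weak solution on the slab with zero weak gradient (from the
parasitic library at `C = 0`). -/
theorem zero_isSuitableWeakSolutionOn_and_grad :
    IsSuitableWeakSolutionOn 𝕊 1 0 (0 : ℝ → ℝ³ → ℝ³) 0 ∧ HasWeakSpatialGradientOn 𝕊 (0 : ℝ → ℝ³ → ℝ³) 0 := by
  have hs := parasitic_isSuitableWeakSolutionOn 0
  have hg := parasitic_hasWeakSpatialGradientOn 0
  rw [parasiticVelocity_zero] at hs hg
  rw [parasiticPressure_zero] at hs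
  have hG : (fun (t : ℝ) (x : ℝ³) => fderiv ℝ ((0 : ℝ → ℝ³ → ℝ³) t) x) = 0 := by
    funext t x
    simp
  rw [hG] at hg
  exact ⟨hs, hg⟩

/-- **The zero flow is in every `InRateClass M C`, `C ≥ 0`** (`𝐈 = 0`). The class of the genealogy
line has no singular point built in; statements over it must survive `u ≡ 0`. -/
theorem inRateClass_zero (M : ℝ≥0) {C : ℝ} (hC : 0 ≤ C) : InRateClass M C 0 0 0 := by
  refine ⟨zero_isSuitableWeakSolutionOn_and_grad.1, zero_isSuitableWeakSolutionOn_and_grad.2, ?_,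
    fun t _ x => ?_⟩
  · rw [typeIBound_zero]
    exact zero_le
  · simp only [Pi.zero_apply, norm_zero]
    positivity

/-- **Unguarded "∃ active point" stubs over `InRateClass` are false** (zero flow), whatever is
then asked of the point: existence of activity must be ASSUMED (singular origin ⇒ activity at all
scales is Barker–Prange concentration, tree `BarkerPrange2020_thm2_holds`) — cf. triage r1-3 (a) on
the card's `NoPerpetualFission`. -/
theorem not_forall_inRateClass_exists_active {η : ℝ} (hη : 0 < η) (M : ℝ≥0) {C : ℝ} (hC : 0 ≤ C)
    (P : (ℝ → ℝ³ → ℝ³) → (ℝ → ℝ³ → ℝ) → (ℝ → ℝ³ → ℝ³ →L[ℝ] ℝ³) → ℝ × ℝ³ → Prop) :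
    ¬ ∀ (u : ℝ → ℝ³ → ℝ³) (p : ℝ → ℝ³ → ℝ) (G : ℝ → ℝ³ → ℝ³ →L[ℝ] ℝ³),
        InRateClass M C u p G → ∃ z ∈ activeSet η u, P u p G z := by
  intro h
  obtain ⟨z, hz, -⟩ := h 0 0 0 (inRateClass_zero M hC)
  rw [activeSet_zero hη] at hz
  exact hz

/-- By contrast, over the SINGULAR class such stubs are (L)-vacuous again (`Negative/LinesVacuity`):
the zero flow is not in `RateClassSingular` (`IsRateProfile.pos`). -/
theorem not_rateClassSingular_zero (C M : ℝ) : ¬ RateClassSingular C M (0 : ℝ → ℝ³ → ℝ³) 0 0 := by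
  intro h
  have hs := h.2.2.2.2 1 one_pos
  rw [show uncurry (0 : ℝ → ℝ³ → ℝ³) = 0 from rfl, eLpNorm_zero] at hs
  exact ENNReal.zero_ne_top hs

end Summit.NavierStokesRegularity.NavierStokesRegularity.Theorems.ApexLocalisation.Negative
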